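/-
Copyright (c) 2026 the pub-hodgecm-mathlib formalisation cell (harness21).  Prover seat hodgecm-mathlib-K2Liu-p13 (g5), Track B «K2-LIT»,
#184♮ = hLiu418 = `stmt-HodgeConjecture-24832`; socket #41, KIND W, (iii-fin) row, brick (ι) — KW desk F0P2-p08 (g3) 2026-09-05T01:01:02Z (LEAD F0P6-plan (g15)
BATCH #203∕#205: «(ι) `Theorems/K2LiuKindWFiniteLevelLetters.lean` is OPEN at the KW desk»).  THEOREMS ONLY (no `def`, no `instance`, no notation, no named-fact hypothesis, no `sorry`);
lane `--supports stmt-HodgeConjecture-24832 --as helper` (count-neutral helper; closes no socket by itself).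
-/
import Summits.HodgeConjecture.HodgeConjecture.Theorems.K2LiuKindOneLineLatticeLocalPrelims  -- ★ (LH4-p18): `exists_defect` (`exp(−c_w) ≤ |x|_w ≤ exp(c_w)`, cofinitely `0`), `ramificationIdx_le_two`; brings ★ (lat-c) `K2LiuKindOneLineLatticeLetters` (`exists_coe_eq_adelicForm_hermD`, `exists_cofinite_localHeight_le_pow`, `localHeight_le_pow_of_placesOver`, ★ (c1), `PlacesOver.eq_or_eq_galInv`) and ★ (lat-a) ED. 2 `K2LiuUnipotentDeepLevel.nElem_apply_mem_congruenceGL_pow_of_two`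
import Summits.HodgeConjecture.HodgeConjecture.Theorems.K2LiuKindWFiniteDualLatticeLetter      -- ★ p863721∕p863825 (F0P2-p09): `valued_toPlace_uniformizer_zpow`; brings ★ `kindWLocalBall` (p863154), ★ `K2LiuUnipDeltaLocalCoordinates`, ★ `K2LiuUnipDeltaLocBridge`
import HarnessLib

/-!
# Crux `HLiu418`, socket #41, KIND W — `K2LiuKindWFiniteLevelLetters` ((ι)): THE (iii-fin) LEVEL LETTERS `lev Tδ₀ δ₀ hδ₀ k hlev` OF ★ p863724's BLOCK,
# WITH THE HEIGHT EXPONENTS `A`, THE BALL EXPONENT `a₀`, THE EXPONENT DOMINATION `e(w|v)·a₀ ≤ lev` AND THE BALL ⟹ LEVEL READING — «the (ι) eleven»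

Cell `hodgecm-mathlib`, crux item hLiu418 = `stmt-HodgeConjecture-24832` (helper lane `--supports … --as helper`, count-neutral), route of record `HCCMUnconditional`;
squad K2 ∕ K2Liu, road `K2_Liu`, socket #41 `sig_K2LiuSiegelEisensteinContinuation`, KIND W, (iii-fin) row; KW desk F0P2-p08 (g3); consumer = K2E3-typ2's tie of ★ p863724
`K2LiuKindWBlockOfRecordCMOfLocalLettersHaar.kindW_block_cm_of_localLetters_haar`, whose (iii-fin) binders read (tree bytes :142–:150)
`(lev : HA → 𝔭_L → ℕ) (Tδ₀) (δ₀) (hδ₀ : ∀ w ∉ Tδ₀, δ₀ w = 0) (k : ℕ) (hlev : ∀ h w, q_w ^ lev h w ≤ q_w ^ δ₀ w · H_w(h) ^ k) (Tc) (c) (hc) (hsuppLoc : …)`, and whose `hsuppLoc` is ★ p863728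
`K2LiuKindWFiniteSupportLetterOfLevel.hsuppLoc_of_level(_guarded) … lev c a₀ hFinv hdual` with `hdual` = ★ p863825 `K2LiuKindWFiniteDualLatticeLetter.hdual_of_exponent_letter … hdom`;
the eleven outputs below are consumed BY VALUE by K2E3-p26's `K2LiuKindWFiniteLettersOfRecord.kindW_finite_letters_of_record` (binders `(A a₀ lev Tδ₀ δ₀ hδ₀ k) (hlev) (hA) (ha₀) (hball)`),
whose `hFinv_of_levelLetters` (over ★ p863964 §4) and (θ) ★ p863993 `hdom_of_conductorLetters` turn `hA`∕`hball` and `ha₀` into `hFinv` and `hdom`.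

THE MATHEMATICS [BorelJacquet1979, §1.2, §4.1], [PlatonovRapinchuk1994, §5.1], [HarishChandra1999, §17 p. 80], [Casselman1980, §3], [MoeglinWaldspurger1995, I.2.2],
[KudlaRallis1994, §2], [Shimura1997, §18.3–18.4], [NeukirchANT1999, Ch. I (8.2)], [CasselsFrohlichANT1967, Ch. VII §1].  The local factor `FvT j S h v s` of the (KW-fac) reading is
right-invariant under the principal level `∏_{w∣v} K_w(ϖ_w^{c_w})` (★ p863964 K2E3-p26 `exists_levels_forall_FvT_mul_eq`, the `(Tc, cL, hcL)` input here); translating by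
the `v`-component of the adelic point `h`, of local heights `H_w(h) = q_w^{A h w}` (★ (c1) `exists_localHeight_eq_pow`), costs `2·A h w` levels (★ (c5) `conj_apply_mem_congruenceGL`,
★ p863964 §4).  A unipotent `u₀` in the KW ball of exponent `a` at `v` (`|B(u₀)_{ij,w}| ≤ |π_v|_w^a = exp(−e(w|v)·a)`, ★ `kindWLocalBall`) has its `w`-component in
`K_w(ϖ_w^M)` as soon as `M + ord_w(2) ≤ e(w|v)·a` (★ (lat-a) ED. 2 `nElem_apply_mem_congruenceGL_pow_of_two`, `u₀ = n(B(u₀))` ★ `eq_nElem_of_mem_unipDeltaLocal`).  Hence ONE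
exponent per place of `L⁺`, symmetric in the places of `L` above it,
  `a₀ h v := Σ_{w′ ∣ v} (c_{w′} + d₂(w′) + 2·A h w′)`   (`d₂` = the dyadic defect `exp(−d₂ w) ≤ |2|_w`, `= 0` off the finitely many dyadic places),
does it for EVERY `w ∣ v` at once (`e(w|v) ≥ 1`), and `lev h w := e(w|v)·a₀ h v` is the exponent-domination EQUALITY that ★ p863825's `hdom` needs.  The bound
`q_w^{lev h w} ≤ q_w^{δ₀ w}·H_w(h)^k` then rests on the SPLIT-PLACE SEAM, already ★: for the UNITARY point `h`, `H_{w̄}(h) ≤ H_w(J^𝔻)·H_w(h)·H_w(J^𝔻)` (★ (lat-c)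
`localHeight_le_pow_of_placesOver` over ★ `K2LiuLocalHeightConjugatePlace`), `H_w(J^𝔻) = q_w^{j_w}` with `j_w = 0` cofinitely, `e(w|v) ≤ 2 = [L : L⁺]` (Mathlib
`Ideal.ramificationIdx_le_finrank`) and `#{w′ ∣ v} ≤ 2` (★ `PlacesOver.eq_or_eq_galInv`): `δ₀ w := 2·((c_w + d₂ w) + (c_{c⁻¹w} + d₂(c⁻¹w))) + 8·j_w`, `k := 8`.
* §1 `one_le_ramificationIdx'`, `sum_placesOver_le` (`Σ_{w′∣v_w} f w′ ≤ f w + f(c⁻¹•w)`); the dyadic defect `d₂` and `e(w|v) ≤ 2` are ★ `K2LiuKindOneLineLatticeLocalPrelims`.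
* §2 **`apply_mem_congruenceGL_of_mem_kindWLocalBall`** — THE BALL ⟹ LEVEL READING at a place `w ∣ v` (dyadic included): `u₀ ∈ kindWLocalBall v π a`, `M + d ≤ e(w|v)·a`,
  `exp(−d) ≤ |2|_w` ⟹ `(u₀)_w ∈ K_w(ϖ_w^M) = congruenceGL (n+n) (valuation ϖ_w ^ M)`.
* §3 HEAD **`exists_levelLetters`** — `∃ A a₀ lev Tδ₀ δ₀ k` with: (A) `H_w(h) ≤ q_w^{A h w}`; (δ) `δ₀ = 0` off `Tδ₀`; (hlev) ★ p863724's binder BYTES :143–:144; (dom)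
  `e(w|v)·a₀ h v ≤ lev h w` (`w ∣ v`); (ball) `u₀ ∈ kindWLocalBall v (π v) (a₀ h v) ⟹ ∀ w ∣ v, (u₀)_w ∈ K_w(ϖ_w^{c_w + 2·A h w})`.  Degenerate rank `n = 0`: `A = k = 0`.
So the tie reads `obtain ⟨A, a₀, lev, Tδ₀, δ₀, k, hA, hδ₀, hlev, ha₀, hball⟩ := exists_levelLetters L e dV hdV dW hdW hdV0 hdW0 π hπ ϖ hϖ Tc cL hcL` and hands the eleven to
`kindW_finite_letters_of_record`.

HONEST LABEL.  Count-neutral helper; it retires nothing by itself: `HC_CM` is proved only modulo the 7 printed citations (2 remaining named inputs: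
hLiu418 = `stmt-HodgeConjecture-24832`, h413 = `stmt-HodgeConjecture-24833`) until rung 0 closes.  NOT HERE: K2E3-p26's level head (its `(Tc, cL, hcL)` is an input),
the (θ) conductor∕defect letters, `hFinv`∕`hdom` themselves (★ p863964 §4 ∕ K2E3-p26's package ∕ ★ p863993).

## References
* [BorelJacquet1979] A. Borel, H. Jacquet, *Automorphic forms and automorphic representations*, Proc. Sympos. Pure Math. 33.1 (1979): §1.2 (heights), §4.1 (levels).
* [PlatonovRapinchuk1994] V. Platonov, A. Rapinchuk, *Algebraic Groups and Number Theory* (1994): §5.1 (principal congruence subgroups, adelic points).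
* [HarishChandra1999] Harish-Chandra (DeBacker–Sally, eds.), *Admissible invariant distributions on reductive p-adic groups*, ULS 16 (1999): §17 p. 80.
* [Casselman1980] W. Casselman, *The unramified principal series of p-adic groups I*, Compositio Math. 40 (1980): §3.
* [MoeglinWaldspurger1995] C. Mœglin, J.-L. Waldspurger, *Spectral decomposition and Eisenstein series* (1995): I.2.2 (local heights, almost all `1`).
* [KudlaRallis1994] S. Kudla, S. Rallis, Ann. of Math. 140 (1994): §2 (support of local Whittaker integrals).  [Shimura1997] G. Shimura, CBMS 93 (1997): §18.3–18.4.
* [NeukirchANT1999] J. Neukirch, *Algebraic Number Theory* (1999): Ch. I (8.2) (`Σ eᵢ fᵢ = n`).  [CasselsFrohlichANT1967] Cassels–Fröhlich (1967): Ch. VII §1 (conjugate places).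
-/

set_option autoImplicit false
-- the mandated namespace repeats the single-problem summit's segment (`HodgeConjecture.HodgeConjecture`)
set_option linter.dupNamespace false

noncomputable section

open scoped NNReal MatrixGroups WithZero BigOperators
open NumberField IsDedekindDomain Matrix ValuativeRel Filter
open Literature.NumberTheory.Automorphic Literature.NumberTheory.Automorphic.UnitaryGroup Literature.NumberTheory.GaloisRepresentations
open Literature.NumberTheory.GelbartRogawski1991 Literature.NumberTheory.GelbartRogawski1991.GRConstruction
open Literature.NumberTheory.GelbartRogawski1991.AdaptedBlocks
open Literature.NumberTheory.GelbartRogawski1991.UnitaryDualPair Literature.NumberTheory.GelbartRogawski1991.UnitaryDualPair.LocalSplitting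
open Literature.NumberTheory.K2Lit.SiegelDoubled Literature.NumberTheory.K2Lit.LocalSiegelDoubled
open Summit.HodgeConjecture.HodgeConjecture.Cruxes.HLiu418.K2LiuSiegelUnipotentLocalDefs
open Summit.HodgeConjecture.HodgeConjecture.Cruxes.HLiu418.K2LiuSiegelUnipotentSplitAtDefs
open Summit.HodgeConjecture.HodgeConjecture.Cruxes.HLiu418.K2LiuSiegelUnipotentFourierDefs
open Summit.HodgeConjecture.HodgeConjecture.Cruxes.HLiu418.K2LiuKindWFiniteLetterDefs (kindWLocalBall mem_kindWLocalBall_iff)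
open Summit.HodgeConjecture.HodgeConjecture.Cruxes.HLiu418.K2LiuKindWFiniteDualLatticeLetter (valued_toPlace_uniformizer_zpow)
open Summit.HodgeConjecture.HodgeConjecture.Cruxes.HLiu418.K2LiuUnipDeltaLocBridge (unipDeltaLoc_eq_unipDeltaLocal)
open Summit.HodgeConjecture.HodgeConjecture.Cruxes.HLiu418.K2LiuUnipDeltaLocalCoordinates (skew_blkB_of_mem_unipDeltaLocal eq_nElem_of_mem_unipDeltaLocal)
open Summit.HodgeConjecture.HodgeConjecture.Cruxes.HLiu418.K2LiuUnipotentDeepLevel (nElem_apply_mem_congruenceGL_pow_of_two)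
open Summit.HodgeConjecture.HodgeConjecture.Cruxes.HLiu418.K2LiuLocalHeightLevelConjugation (exists_localHeight_eq_pow one_lt_absNorm_nnreal)
open Summit.HodgeConjecture.HodgeConjecture.Cruxes.HLiu418.K2LiuKindOneLineLatticeLetters
  (exists_coe_eq_adelicForm_hermD exists_cofinite_localHeight_le_pow localHeight_le_pow_of_placesOver)
open Summit.HodgeConjecture.HodgeConjecture.Cruxes.HLiu418.K2LiuKindOneLineLatticeLocalPrelims (exists_defect ramificationIdx_le_two)

namespace Summit.HodgeConjecture.HodgeConjecture.Cruxes.HLiu418.K2LiuKindWFiniteLevelLetters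

variable (L : Type) [Field L] [NumberField L] [IsCMField L]

/-! ## §1 `1 ≤ e(w|v)`, and sums over the places above one place of `L⁺` (the dyadic defect `d₂` and `e(w|v) ≤ 2` are ★ `K2LiuKindOneLineLatticeLocalPrelims`) -/

omit [IsCMField L] in
/-- **`1 ≤ e(w|v)`** (a place above `v` is a factor of `v·𝓞_L`; Mathlib `ramificationIdx'_ne_zero_of_liesOver`). [cite: NeukirchANT1999, Ch. I (8.2)] -/
theorem one_le_ramificationIdx' (v : HeightOneSpectrum (𝓞 (Fp L))) (w : UnitaryGroup.PlacesOver L v) :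
    1 ≤ v.asIdeal.ramificationIdx' w.1.asIdeal := by
  haveI : w.1.asIdeal.LiesOver v.asIdeal := ⟨congrArg HeightOneSpectrum.asIdeal w.2.symm⟩
  exact Nat.one_le_iff_ne_zero.2 (Ideal.IsDedekindDomain.ramificationIdx'_ne_zero_of_liesOver w.1.asIdeal v.ne_bot)

/-- **A SUM OVER THE PLACES ABOVE `v = w ∩ L⁺` IS AT MOST THE SUM OVER `{w, c⁻¹•w}`**: the places of `L` above `v` are `w` and `c⁻¹ • w` (★ `PlacesOver.eq_or_eq_galInv`; they may
coincide, whence `≤`). [cite: CasselsFrohlichANT1967, Ch. VII §1] -/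
theorem sum_placesOver_le (f : HeightOneSpectrum (𝓞 L) → ℕ) (w : HeightOneSpectrum (𝓞 L)) :
    ∑ w' : UnitaryGroup.PlacesOver L (w.under (𝓞 (Fp L))), f w'.1 ≤ f w + f ((IsCMField.complexConj L)⁻¹ • w) := by
  classical
  haveI : Algebra.IsQuadraticExtension (Fp L) L := IsCMField.isQuadraticExtension L
  set p₁ : UnitaryGroup.PlacesOver L (w.under (𝓞 (Fp L))) := ⟨w, rfl⟩ with hp₁
  set p₂ : UnitaryGroup.PlacesOver L (w.under (𝓞 (Fp L))) := PlacesOver.galInv (IsCMField.complexConj L) p₁ with hp₂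
  have hsub : (Finset.univ : Finset (UnitaryGroup.PlacesOver L (w.under (𝓞 (Fp L))))) ⊆ {p₁, p₂} := fun w' _ => by
    rcases PlacesOver.eq_or_eq_galInv (F := Fp L) (E := L) (IsCMField.complexConj L) (IsCMField.complexConj_ne_one L) p₁ w' with rfl | rfl
    · exact Finset.mem_insert_self _ _
    · exact Finset.mem_insert_of_mem (Finset.mem_singleton_self _)
  refine (Finset.sum_le_sum_of_subset hsub).trans ?_
  by_cases h12 : p₁ = p₂
  · rw [← h12, Finset.insert_eq_of_mem (Finset.mem_singleton_self p₁), Finset.sum_singleton]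
    exact Nat.le_add_right _ _
  · rw [Finset.sum_pair h12]

/-! ## §2 The ball ⟹ level reading at one place above `v` (dyadic places included) -/

section Ball

variable {N M n : ℕ} (e : Fin N × Fin M ≃ Fin n)
  (dV : Fin N → L) (hdV : ∀ i, IsCMField.complexConj L (dV i) = dV i)
  (dW : Fin M → L) (hdW : ∀ i, IsCMField.complexConj L (dW i) = dW i)

/-- **THE KW BALL OF EXPONENT `a` AT `v` LIES IN THE LEVEL `K_w(ϖ_w^M)` AT `w ∣ v` AS SOON AS `M + ord_w 2 ≤ e(w|v)·a`.**  For `u₀ ∈ N_Δ(L⁺_v)` in ★ `kindWLocalBall v π a`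
(`|B(u₀)_{ij,w′}| ≤ |ι_{w′} π|^a` at every `w′ ∣ v`, `π` a uniformiser of `L⁺_v`), a place `w ∣ v` with uniformiser `ϖ` (`|ϖ|_w = exp(−1)`), and `M d : ℕ` with `exp(−d) ≤ |2|_w`
and `M + d ≤ e(w|v)·a`: the `w`-component of `u₀` lies in `congruenceGL (n+n) (valuation ϖ ^ M)`.  Indeed `u₀ = n(B(u₀))` (★ `eq_nElem_of_mem_unipDeltaLocal`),
`|B(u₀)_{ij,w}| ≤ |ι_w π|^a = exp(−e(w|v)·a) ≤ exp(−d)·exp(−M) ≤ |2|_w·|ϖ|^M` (★ `valued_toPlace_uniformizer_zpow`), and deep unipotents are deep at EVERY place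
(★ (lat-a) ED. 2 `nElem_apply_mem_congruenceGL_pow_of_two`; the two valuation spellings by ★ `v_le_iff_valuation_le`).
[cite: PlatonovRapinchuk1994, §5.1] [cite: Casselman1980, §3] [cite: KudlaRallis1994, §2] -/
theorem apply_mem_congruenceGL_of_mem_kindWLocalBall (v : HeightOneSpectrum (𝓞 (Fp L)))
    {π : v.adicCompletion (Fp L)} (hπ : Valued.v π = WithZero.exp (-1 : ℤ))
    (u₀ : ↥(unipDeltaLoc L e dV hdV dW hdW v)) {a : ℤ} (hu₀ : u₀ ∈ kindWLocalBall L e dV hdV dW hdW v π a)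
    (w : UnitaryGroup.PlacesOver L v) {ϖ : w.1.adicCompletion L} (hϖ : Valued.v ϖ = WithZero.exp (-1 : ℤ)) (M d : ℕ)
    (h2 : WithZero.exp (-(d : ℤ)) ≤ Valued.v ((2 : L) : w.1.adicCompletion L))
    (hM : (M : ℤ) + d ≤ (v.asIdeal.ramificationIdx' w.1.asIdeal : ℤ) * a) :
    ((u₀ : UnitaryGroup.localPi L (IsCMField.complexConj L) (n + n) (hermD L e dV hdV dW hdW) v) : UnitaryGroup.LocalGLPi L (n + n) v) w ∈
      congruenceGL (n + n) (valuation (w.1.adicCompletion L) ϖ ^ M) := by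
  -- `u₀ = n(B(u₀))` with `B(u₀)` skew
  have hu : (u₀ : UnitaryGroup.localPi L (IsCMField.complexConj L) (n + n) (hermD L e dV hdV dW hdW) v) ∈
      unipDeltaLocal (Fp L) L (IsCMField.complexConj L) v n (JD := hermD L e dV hdV dW hdW) := by
    rw [← unipDeltaLoc_eq_unipDeltaLocal L e dV hdV dW hdW v]; exact u₀.2
  -- `|ϖ|_w ≤ 1` in the `ValuativeRel` spelling
  have hϖ1 : valuation (w.1.adicCompletion L) ϖ ≤ 1 := by
    have h1 : Valued.v ϖ ≤ Valued.v (1 : w.1.adicCompletion L) := by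
      rw [hϖ, map_one, ← WithZero.exp_zero]
      exact WithZero.exp_le_exp.2 (by norm_num)
    simpa only [map_one] using (v_le_iff_valuation_le _ _).1 h1
  -- `((2 : L) : L_w) = 2`
  have h2w : ((2 : L) : w.1.adicCompletion L) = 2 := map_ofNat (algebraMap L (w.1.adicCompletion L)) 2
  -- the entries of `B(u₀)` at `w`: `≤ exp(−e·a) ≤ |2|_w · |ϖ|^M`
  have htM : ∀ i j, valuation (w.1.adicCompletion L)
      (blkB (matA (Fp L) L (IsCMField.complexConj L) v n
        (u₀ : UnitaryGroup.localPi L (IsCMField.complexConj L) (n + n) (hermD L e dV hdV dW hdW) v)) i j w) ≤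
      valuation (w.1.adicCompletion L) (2 : w.1.adicCompletion L) * valuation (w.1.adicCompletion L) ϖ ^ M := by
    intro i j
    have hB := (mem_kindWLocalBall_iff L e dV hdV dW hdW v π a u₀).1 hu₀ i j w
    rw [valued_toPlace_uniformizer_zpow L v hπ w a] at hB
    have hϖM : Valued.v ((2 : w.1.adicCompletion L) * ϖ ^ M) = Valued.v (2 : w.1.adicCompletion L) * WithZero.exp (-(M : ℤ)) := by
      rw [map_mul, map_pow, hϖ, ← WithZero.exp_nsmul, nsmul_eq_mul, mul_neg, mul_one]
    have hle : Valued.v (blkB (matA (Fp L) L (IsCMField.complexConj L) v n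
        (u₀ : UnitaryGroup.localPi L (IsCMField.complexConj L) (n + n) (hermD L e dV hdV dW hdW) v)) i j w) ≤
        Valued.v ((2 : w.1.adicCompletion L) * ϖ ^ M) := by
      refine hB.trans ?_
      rw [hϖM, ← h2w]
      calc WithZero.exp (-((v.asIdeal.ramificationIdx' w.1.asIdeal : ℤ) * a))
          ≤ WithZero.exp (-(d : ℤ)) * WithZero.exp (-(M : ℤ)) := by
            rw [← WithZero.exp_add, WithZero.exp_le_exp]
            linarith
        _ ≤ Valued.v ((2 : L) : w.1.adicCompletion L) * WithZero.exp (-(M : ℤ)) := mul_le_mul' h2 le_rfl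
    have h := (v_le_iff_valuation_le _ _).1 hle
    rwa [map_mul, map_pow] at h
  have key := nElem_apply_mem_congruenceGL_pow_of_two (Fp L) L (IsCMField.complexConj L) v n (hermD_eq_map_gramD L e dV hdV dW hdW)
    (skew_blkB_of_mem_unipDeltaLocal (Fp L) L (IsCMField.complexConj L) v n (hermD_eq_map_gramD L e dV hdV dW hdW) hu) hϖ1 M htM
  rwa [← eq_nElem_of_mem_unipDeltaLocal (Fp L) L (IsCMField.complexConj L) v n (hermD_eq_map_gramD L e dV hdV dW hdW) hu] at key

end Ball

/-! ## §3 HEAD — the (iii-fin) level letters of ★ p863724's block, with the ball exponent and the ball ⟹ level reading -/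

section Head

variable {N M n : ℕ} (e : Fin N × Fin M ≃ Fin n)
  (dV : Fin N → L) (hdV : ∀ i, IsCMField.complexConj L (dV i) = dV i)
  (dW : Fin M → L) (hdW : ∀ i, IsCMField.complexConj L (dW i) = dW i)

/-- **THE (iii-fin) LEVEL LETTERS `lev Tδ₀ δ₀ hδ₀ k hlev` OF ★ p863724 `kindW_block_cm_of_localLetters_haar`, WITH THE BALL EXPONENT `a₀`, THE HEIGHT EXPONENTS `A`, THE
EXPONENT DOMINATION AND THE BALL ⟹ LEVEL READING.**  Data: the KW frame, uniformisers `π_v` of the places of `L⁺` and `ϖ_w` of the places of `L`, and level exponents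
`cL : 𝔭_L → ℕ` zero off `Tc` (K2E3-p26's `exists_levels_forall_FvT_mul_eq` output, BY VALUE).  Conclusion: `∃ A a₀ lev Tδ₀ δ₀ k` with
(A) `H_w(h) ≤ q_w ^ A h w` for all `h w` (`=` when `n ≠ 0`, ★ (c1) `exists_localHeight_eq_pow`; `A = 0` at `n = 0`);
(δ) `δ₀ w = 0` off `Tδ₀`;
(hlev) `q_w ^ lev h w ≤ q_w ^ δ₀ w · H_w(h) ^ k` — ★ p863724's binder BYTES;
(dom) `e(w|v) · a₀ h v ≤ lev h w` for `w ∣ v` (an equality: `lev h w := e(w|v)·a₀ h (w ∩ L⁺)`), the input of (θ) ★ p863993 `hdom_of_conductorLetters`;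
(ball) `u₀ ∈ kindWLocalBall v (π v) (a₀ h v) ⟹ ∀ w ∣ v, (u₀)_w ∈ congruenceGL (n+n) (valuation ϖ_w ^ (cL w + 2·A h w))` (§2), the input (with (A)) of K2E3-p26's
`hFinv_of_levelLetters` over ★ p863964 §4 `FvT_mul_mul_evalPlace_eq`.
Witnesses: `a₀ h v := Σ_{w′∣v} (cL w′ + d₂ w′ + 2·A h w′)` (★ `exists_defect` at `x := 2` gives `d₂`), `δ₀ w := 2·((cL w + d₂ w) + (cL (c⁻¹•w) + d₂ (c⁻¹•w))) + 8·j w` (`H_w(J^𝔻) ≤ q_w^{j w}`, `j` cofinitely `0`, ★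
`exists_cofinite_localHeight_le_pow`), `k := 8` — the split-place seam `A h w̄ ≤ 2 j w + A h w` is ★ `localHeight_le_pow_of_placesOver` (`h ∈ U(J^𝔻)(𝔸)`; this is where `hdV0 hdW0` enter).
[cite: BorelJacquet1979, §1.2, §4.1] [cite: PlatonovRapinchuk1994, §5.1] [cite: MoeglinWaldspurger1995, I.2.2] [cite: KudlaRallis1994, §2] [cite: NeukirchANT1999, Ch. I (8.2)] -/
theorem exists_levelLetters (hdV0 : ∀ i, dV i ≠ 0) (hdW0 : ∀ i, dW i ≠ 0)
    (π : ∀ v : HeightOneSpectrum (𝓞 (Fp L)), v.adicCompletion (Fp L)) (hπ : ∀ v, Valued.v (π v) = WithZero.exp (-1 : ℤ))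
    (ϖ : ∀ w : HeightOneSpectrum (𝓞 L), w.adicCompletion L) (hϖ : ∀ w, Valued.v (ϖ w) = WithZero.exp (-1 : ℤ))
    (Tc : Finset (HeightOneSpectrum (𝓞 L))) (cL : HeightOneSpectrum (𝓞 L) → ℕ) (hcL : ∀ w ∉ Tc, cL w = 0) :
    ∃ (A : HA L e dV hdV dW hdW → HeightOneSpectrum (𝓞 L) → ℕ) (a₀ : HA L e dV hdV dW hdW → HeightOneSpectrum (𝓞 (Fp L)) → ℤ)
      (lev : HA L e dV hdV dW hdW → HeightOneSpectrum (𝓞 L) → ℕ) (Tδ₀ : Finset (HeightOneSpectrum (𝓞 L))) (δ₀ : HeightOneSpectrum (𝓞 L) → ℕ) (k : ℕ),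
      (∀ (h : HA L e dV hdV dW hdW) (w : HeightOneSpectrum (𝓞 L)),
        GLn.localHeight (n + n) L w (h : GL (Fin (n + n)) (AdeleRing (𝓞 L) L)) ≤ ((Ideal.absNorm w.asIdeal : ℕ) : ℝ≥0) ^ A h w) ∧
      (∀ w ∉ Tδ₀, δ₀ w = 0) ∧
      (∀ (h : HA L e dV hdV dW hdW) (w : HeightOneSpectrum (𝓞 L)),
          ((Ideal.absNorm w.asIdeal : ℕ) : ℝ) ^ lev h w ≤ ((Ideal.absNorm w.asIdeal : ℕ) : ℝ) ^ δ₀ w * (GLn.localHeight (n + n) L w (h : GL (Fin (n + n)) (AdeleRing (𝓞 L) L)) : ℝ) ^ k) ∧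
      (∀ (h : HA L e dV hdV dW hdW) (v : HeightOneSpectrum (𝓞 (Fp L))) (w : UnitaryGroup.PlacesOver L v),
        (v.asIdeal.ramificationIdx' w.1.asIdeal : ℤ) * a₀ h v ≤ ((lev h w.1 : ℕ) : ℤ)) ∧
      (∀ (h : HA L e dV hdV dW hdW) (v : HeightOneSpectrum (𝓞 (Fp L))) (u₀ : ↥(unipDeltaLoc L e dV hdV dW hdW v)),
        u₀ ∈ kindWLocalBall L e dV hdV dW hdW v (π v) (a₀ h v) →
        ∀ w : UnitaryGroup.PlacesOver L v,
          ((u₀ : UnitaryGroup.localPi L (IsCMField.complexConj L) (n + n) (hermD L e dV hdV dW hdW) v) : UnitaryGroup.LocalGLPi L (n + n) v) w ∈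
            congruenceGL (n + n) (valuation (w.1.adicCompletion L) (ϖ w.1) ^ (cL w.1 + 2 * A h w.1))) := by
  classical
  -- the dyadic defect `exp(−d₂ w) ≤ |2|_w`, `d₂` cofinitely `0` (★ `exists_defect`)
  obtain ⟨d₂, hd₂, h2⟩ := exists_defect L (x := (2 : L)) two_ne_zero
  -- the height exponents `A`, the exponent `k`, the form's heights `j` (cofinitely `0`), and the A-part of `hlev` — by cases on the rank
  obtain ⟨A, k, j, hjev, hA, hAk⟩ : ∃ (A : HA L e dV hdV dW hdW → HeightOneSpectrum (𝓞 L) → ℕ) (k : ℕ) (j : HeightOneSpectrum (𝓞 L) → ℕ),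
      (∀ᶠ w in cofinite, j w = 0) ∧
      (∀ (h : HA L e dV hdV dW hdW) (w : HeightOneSpectrum (𝓞 L)),
        GLn.localHeight (n + n) L w (h : GL (Fin (n + n)) (AdeleRing (𝓞 L) L)) ≤ ((Ideal.absNorm w.asIdeal : ℕ) : ℝ≥0) ^ A h w) ∧
      (∀ (h : HA L e dV hdV dW hdW) (w : HeightOneSpectrum (𝓞 L)),
        ((Ideal.absNorm w.asIdeal : ℕ) : ℝ) ^ (4 * ∑ w' : UnitaryGroup.PlacesOver L (w.under (𝓞 (Fp L))), A h w'.1) ≤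
          ((Ideal.absNorm w.asIdeal : ℕ) : ℝ) ^ (8 * j w) * (GLn.localHeight (n + n) L w (h : GL (Fin (n + n)) (AdeleRing (𝓞 L) L)) : ℝ) ^ k) := by
    rcases Nat.eq_zero_or_pos n with hn0 | hpos
    · -- degenerate rank `n = 0`: empty matrices, `A = k = j = 0`
      subst hn0
      refine ⟨fun _ _ => 0, 0, fun _ => 0, Filter.Eventually.of_forall fun _ => rfl, fun h w => ?_, fun h w => ?_⟩
      · rw [pow_zero]
        unfold GLn.localHeight
        exact Finset.sup_le fun ij _ => ij.1.elim0
      · simp only [Finset.sum_const_zero, mul_zero, pow_zero, mul_one, le_refl]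
    · haveI : NeZero (n + n) := ⟨by omega⟩
      choose A hA using fun (h : HA L e dV hdV dW hdW) (w : HeightOneSpectrum (𝓞 L)) =>
        exists_localHeight_eq_pow L w (h : GL (Fin (n + n)) (AdeleRing (𝓞 L) L))
      obtain ⟨Jm, hJm⟩ := exists_coe_eq_adelicForm_hermD L e dV hdV dW hdW hdV0 hdW0
      obtain ⟨j, hjev, hJw⟩ := exists_cofinite_localHeight_le_pow L Jm
      refine ⟨A, 8, j, hjev, fun h w => (hA h w).le, fun h w => ?_⟩
      -- both places above `v = w ∩ L⁺` are controlled by `H_w(h) = q_w^{A h w}`: `A h w′ ≤ j w + A h w + j w`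
      have hw' : ∀ w' : UnitaryGroup.PlacesOver L (w.under (𝓞 (Fp L))), A h w'.1 ≤ j w + A h w + j w := fun w' => by
        have hle := localHeight_le_pow_of_placesOver L e dV hdV dW hdW Jm hJm j hJw h w (hA h w) w'
        rw [hA h w'.1] at hle
        exact (pow_le_pow_iff_right₀ (one_lt_absNorm_nnreal L w'.1)).1 hle
      have hSA : ∑ w' : UnitaryGroup.PlacesOver L (w.under (𝓞 (Fp L))), A h w'.1 ≤ 2 * A h w + 2 * j w := by
        refine (sum_placesOver_le L (A h) w).trans ?_
        have h2 := hw' (PlacesOver.galInv (IsCMField.complexConj L) ⟨w, rfl⟩)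
        change A h ((IsCMField.complexConj L)⁻¹ • w) ≤ j w + A h w + j w at h2
        omega
      have hq1 : (1 : ℝ) ≤ ((Ideal.absNorm w.asIdeal : ℕ) : ℝ) := by exact_mod_cast (one_lt_absNorm_nnreal L w).le
      have hH : (GLn.localHeight (n + n) L w (h : GL (Fin (n + n)) (AdeleRing (𝓞 L) L)) : ℝ) = ((Ideal.absNorm w.asIdeal : ℕ) : ℝ) ^ A h w := by
        rw [hA h w, NNReal.coe_pow, NNReal.coe_natCast]
      calc ((Ideal.absNorm w.asIdeal : ℕ) : ℝ) ^ (4 * ∑ w' : UnitaryGroup.PlacesOver L (w.under (𝓞 (Fp L))), A h w'.1)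
          ≤ ((Ideal.absNorm w.asIdeal : ℕ) : ℝ) ^ (8 * j w + A h w * 8) := pow_le_pow_right₀ hq1 (by omega)
        _ = ((Ideal.absNorm w.asIdeal : ℕ) : ℝ) ^ (8 * j w) * (GLn.localHeight (n + n) L w (h : GL (Fin (n + n)) (AdeleRing (𝓞 L) L)) : ℝ) ^ 8 := by
            rw [hH, ← pow_mul, ← pow_add]
  -- the witnesses
  refine ⟨A, fun h v => ((∑ w' : UnitaryGroup.PlacesOver L v, (cL w'.1 + d₂ w'.1 + 2 * A h w'.1) : ℕ) : ℤ),
    fun h w => (w.under (𝓞 (Fp L))).asIdeal.ramificationIdx' w.asIdeal * ∑ w' : UnitaryGroup.PlacesOver L (w.under (𝓞 (Fp L))), (cL w'.1 + d₂ w'.1 + 2 * A h w'.1),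
    ?_, fun w => 2 * ((cL w + d₂ w) + (cL ((IsCMField.complexConj L)⁻¹ • w) + d₂ ((IsCMField.complexConj L)⁻¹ • w))) + 8 * j w, k, hA, ?_, fun h w => ?_,
    fun h v w => ?_, fun h v u₀ hu₀ w => ?_⟩
  · -- `Tδ₀` := the finite set where `δ₀ ≠ 0`
    exact (Filter.eventually_cofinite.1 (show ∀ᶠ w : HeightOneSpectrum (𝓞 L) in cofinite,
      2 * ((cL w + d₂ w) + (cL ((IsCMField.complexConj L)⁻¹ • w) + d₂ ((IsCMField.complexConj L)⁻¹ • w))) + 8 * j w = 0 from by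
        have h1 : ∀ᶠ w : HeightOneSpectrum (𝓞 L) in cofinite, cL w = 0 := Tc.eventually_cofinite_notMem.mono hcL
        have h1' : ∀ᶠ w : HeightOneSpectrum (𝓞 L) in cofinite, cL ((IsCMField.complexConj L)⁻¹ • w) = 0 :=
          (MulAction.injective (β := HeightOneSpectrum (𝓞 L)) (IsCMField.complexConj L)⁻¹).tendsto_cofinite.eventually h1
        have h3 : ∀ᶠ w : HeightOneSpectrum (𝓞 L) in cofinite, d₂ w = 0 := hd₂
        have h3' : ∀ᶠ w : HeightOneSpectrum (𝓞 L) in cofinite, d₂ ((IsCMField.complexConj L)⁻¹ • w) = 0 :=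
          (MulAction.injective (β := HeightOneSpectrum (𝓞 L)) (IsCMField.complexConj L)⁻¹).tendsto_cofinite.eventually h3
        filter_upwards [h1, h1', h3, h3', hjev] with w e1 e2 e3 e4 e5
        simp only [e1, e2, e3, e4, e5, add_zero, mul_zero])).toFinset
  · -- (δ) `δ₀ = 0` off `Tδ₀`
    intro w hw
    by_contra hne
    exact hw ((Set.Finite.mem_toFinset _).2 hne)
  · -- (hlev) `q_w ^ lev h w ≤ q_w ^ δ₀ w · H_w(h) ^ k`
    have hq1 : (1 : ℝ) ≤ ((Ideal.absNorm w.asIdeal : ℕ) : ℝ) := by exact_mod_cast (one_lt_absNorm_nnreal L w).le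
    have he2 := ramificationIdx_le_two L (w.under (𝓞 (Fp L))) ⟨w, rfl⟩
    have hS₁ := sum_placesOver_le L (fun w'' => cL w'' + d₂ w'') w
    have hsplit : ∑ w' : UnitaryGroup.PlacesOver L (w.under (𝓞 (Fp L))), (cL w'.1 + d₂ w'.1 + 2 * A h w'.1) =
        (∑ w' : UnitaryGroup.PlacesOver L (w.under (𝓞 (Fp L))), (cL w'.1 + d₂ w'.1)) +
          2 * ∑ w' : UnitaryGroup.PlacesOver L (w.under (𝓞 (Fp L))), A h w'.1 := by
      rw [Finset.sum_add_distrib, Finset.mul_sum]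
    have hle : (w.under (𝓞 (Fp L))).asIdeal.ramificationIdx' w.asIdeal *
        ∑ w' : UnitaryGroup.PlacesOver L (w.under (𝓞 (Fp L))), (cL w'.1 + d₂ w'.1 + 2 * A h w'.1) ≤
        2 * ((cL w + d₂ w) + (cL ((IsCMField.complexConj L)⁻¹ • w) + d₂ ((IsCMField.complexConj L)⁻¹ • w))) +
          4 * ∑ w' : UnitaryGroup.PlacesOver L (w.under (𝓞 (Fp L))), A h w'.1 := by
      rw [hsplit]
      refine (Nat.mul_le_mul_right _ he2).trans ?_
      change (∑ w' : UnitaryGroup.PlacesOver L (w.under (𝓞 (Fp L))), (cL w'.1 + d₂ w'.1)) ≤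
        (cL w + d₂ w) + (cL ((IsCMField.complexConj L)⁻¹ • w) + d₂ ((IsCMField.complexConj L)⁻¹ • w)) at hS₁
      omega
    calc ((Ideal.absNorm w.asIdeal : ℕ) : ℝ) ^ ((w.under (𝓞 (Fp L))).asIdeal.ramificationIdx' w.asIdeal *
          ∑ w' : UnitaryGroup.PlacesOver L (w.under (𝓞 (Fp L))), (cL w'.1 + d₂ w'.1 + 2 * A h w'.1))
        ≤ ((Ideal.absNorm w.asIdeal : ℕ) : ℝ) ^ (2 * ((cL w + d₂ w) + (cL ((IsCMField.complexConj L)⁻¹ • w) + d₂ ((IsCMField.complexConj L)⁻¹ • w))) +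
            4 * ∑ w' : UnitaryGroup.PlacesOver L (w.under (𝓞 (Fp L))), A h w'.1) := pow_le_pow_right₀ hq1 hle
      _ = ((Ideal.absNorm w.asIdeal : ℕ) : ℝ) ^ (2 * ((cL w + d₂ w) + (cL ((IsCMField.complexConj L)⁻¹ • w) + d₂ ((IsCMField.complexConj L)⁻¹ • w)))) *
            ((Ideal.absNorm w.asIdeal : ℕ) : ℝ) ^ (4 * ∑ w' : UnitaryGroup.PlacesOver L (w.under (𝓞 (Fp L))), A h w'.1) := pow_add _ _ _
      _ ≤ ((Ideal.absNorm w.asIdeal : ℕ) : ℝ) ^ (2 * ((cL w + d₂ w) + (cL ((IsCMField.complexConj L)⁻¹ • w) + d₂ ((IsCMField.complexConj L)⁻¹ • w)))) *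
            (((Ideal.absNorm w.asIdeal : ℕ) : ℝ) ^ (8 * j w) * (GLn.localHeight (n + n) L w (h : GL (Fin (n + n)) (AdeleRing (𝓞 L) L)) : ℝ) ^ k) :=
          mul_le_mul_of_nonneg_left (hAk h w) (pow_nonneg (zero_le_one.trans hq1) _)
      _ = ((Ideal.absNorm w.asIdeal : ℕ) : ℝ) ^ (2 * ((cL w + d₂ w) + (cL ((IsCMField.complexConj L)⁻¹ • w) + d₂ ((IsCMField.complexConj L)⁻¹ • w))) + 8 * j w) *
            (GLn.localHeight (n + n) L w (h : GL (Fin (n + n)) (AdeleRing (𝓞 L) L)) : ℝ) ^ k := by rw [pow_add, mul_assoc]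
  · -- (dom) `e(w|v) · a₀ h v ≤ lev h w` (equality)
    obtain ⟨w, rfl⟩ := w
    push_cast
    exact le_rfl
  · -- (ball) §2 at `M := cL w + 2·A h w`, `d := d₂ w`: one summand of `a₀ h v` is `M + d`, and `e(w|v) ≥ 1`
    refine apply_mem_congruenceGL_of_mem_kindWLocalBall L e dV hdV dW hdW v (hπ v) u₀ hu₀ w (hϖ w.1) (cL w.1 + 2 * A h w.1) (d₂ w.1) (h2 w.1).2 ?_
    have h1 : cL w.1 + d₂ w.1 + 2 * A h w.1 ≤ ∑ w' : UnitaryGroup.PlacesOver L v, (cL w'.1 + d₂ w'.1 + 2 * A h w'.1) :=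
      Finset.single_le_sum (f := fun w' : UnitaryGroup.PlacesOver L v => cL w'.1 + d₂ w'.1 + 2 * A h w'.1) (fun _ _ => Nat.zero_le _) (Finset.mem_univ w)
    have he1 := one_le_ramificationIdx' L v w
    have h0 : (0 : ℤ) ≤ ((∑ w' : UnitaryGroup.PlacesOver L v, (cL w'.1 + d₂ w'.1 + 2 * A h w'.1) : ℕ) : ℤ) := Nat.cast_nonneg _
    calc ((cL w.1 + 2 * A h w.1 : ℕ) : ℤ) + (d₂ w.1 : ℕ)
        ≤ ((∑ w' : UnitaryGroup.PlacesOver L v, (cL w'.1 + d₂ w'.1 + 2 * A h w'.1) : ℕ) : ℤ) := by exact_mod_cast (by omega)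
      _ ≤ (v.asIdeal.ramificationIdx' w.1.asIdeal : ℤ) * ((∑ w' : UnitaryGroup.PlacesOver L v, (cL w'.1 + d₂ w'.1 + 2 * A h w'.1) : ℕ) : ℤ) :=
          le_mul_of_one_le_left h0 (by exact_mod_cast he1)

end Head

end Summit.HodgeConjecture.HodgeConjecture.Cruxes.HLiu418.K2LiuKindWFiniteLevelLetters

end
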